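import Literature.AnabelianGeometry.AbsoluteAnabelian.AbsTopII.InertiaDecompositionProducts
import Literature.AnabelianGeometry.AbsoluteAnabelian.AbsTopII.InertiaDecompositionProofs

/-!
# [AbsTopII] Prop 1.3 (ii): "`1 → Π_e → I_e → I → 1`" for a node, PROVED from the printed inputs

S. Mochizuki, *Topics in Absolute Anabelian Geometry II* [AbsTopII] (bib `MochizukiAbsTopII2013`;
locators = PDF pages of the kurims manuscript `paper:url-585b8d0ad0d9`), §1, Proposition 1.3 (ii)
p. 11; proof pp. 12–13.  The printed proof COMPUTES, for a node `e`, the maximal pro-`Σ` quotient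
`Π^Σ_ν` of the log fundamental group of the node `ν^{log}` ("by considering the Galois groups of the
various Kummer log étale coverings of `ν^{log}`": `Π^Σ_ν ≅ Hom(M^{gp}_e ⊗ ℚ/ℤ, k^×) ⊗ Ẑ^Σ`), and
obtains (p. 13):

  "In particular, it follows that we obtain an injection `Π^Σ_ν ↪ Π_I` whose image contains `Π_e`
  and surjects onto `I`. Since `Π^Σ_ν` is abelian, it follows that the image `Im(Π^Σ_ν)` of this
  injection is contained in `I_e`; since `I_e ∩ Π_𝔾 = Π_e` [cf. [Mzk13], Proposition 1.2, (ii)], we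
  thus conclude that `Im(Π^Σ_ν) = I_e`. Now it follows immediately from the definitions that
  `I_v, I_{v'} ⊆ I_e`; moreover, one computes immediately that [...] the subgroups `I_v, I_{v'} ⊆ I_e`
  correspond to the subgroups of `Hom(M^{gp}_e ⊗ ℚ/ℤ, k^×) ⊗ Ẑ^Σ` consisting of homomorphisms that
  vanish on `ξ`, `η`, respectively. Now the various assertions contained in the statement of
  assertion (ii) follow immediately."

This proof-only file (no definitions) isolates the GROUP THEORY of that paragraph over abc-iut-L4-t4's
abstract `DPSCData` (REAL `I_e := Z_{Π_I}(Π_e)`, `AbsTopII/DecompositionGroups.lean`) and concludes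
abc-iut-L4-t6's typed predicate `DPSCIndexData.Prop_1_3_ii` (FACT-LIST F-0298,
`AbsTopII/InertiaGroups.lean`):

* `AbsTopII.IsInternalProduct.comm_of_comm` — an internal product of two commutative, mutually
  commuting subgroups is commutative ("`≅ Ẑ^Σ × Ẑ^Σ`" ⇒ "`Π^Σ_ν` is abelian");
* `DPSCData.IvNode_inf_PiG_eq` — "`I_e ∩ Π_𝔾 = Π_e` [cf. [Mzk13], Proposition 1.2, (ii)]": for the
  typed `I_e = Z_{Π_I}(Π_e)` this is `Z ∩ Π_𝔾 ⊆ C_{Π_𝔾}(Π_e) = Π_e` (commensurable terminality) and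
  `Π_e ⊆ Z(Π_e)` (`Π_e` abelian);
* `DPSCData.IvNode_eq_of_image` — THE IDENTIFICATION "`Im(Π^Σ_ν) = I_e`": an abelian subgroup
  `J ≤ Π_I` containing `Π_e` with `J · Π_𝔾 = Π_I` EQUALS `I_e`;
* `AbsTopII.DPSCIndexData.prop_1_3_ii_of_inputs : … → X.Prop_1_3_ii` — (ii) as typed, from
  [CombGC] Prop 1.2 (ii) for `Π_e` and the printed computation of `Im(Π^Σ_ν)` stated for an
  ABSTRACT subgroup `J` (contains `Π_e`, surjects onto `I`, `≅ Ẑ^Σ × Ẑ^Σ`, carries `I_v × I_{v'}`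
  openly with index `i^Σ_e`) — the identification with `I_e` being what is PROVED.

Companion of abc-iut-L4-t6's `InertiaDecomposition{Core,Proofs,Openness,Products}.lean` (SUBDAG
`plan/L4/SUBDAG-AbsTopII-Prop13.md`: (ii) was listed as a geometric input; this file splits off its
group-theoretic last step exactly as file (E) did for (iii)).  The log-geometric computation of
`Π^Σ_ν` stays a hypothesis (typed ≠ proved).
HONEST FRAMING: classical group theory; nothing here bears on [IUTchIII] Cor 3.12.
-/

open scoped Pointwise

namespace Literature.AnabelianGeometry.AbsoluteAnabelian

universe u

/-! ## Generic group theory -/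

section GroupTheory

variable {G : Type u} [Group G]

/-- "as abstract profinite groups, `≅ Ẑ^Σ × Ẑ^Σ`" ⇒ abelian: an internal product `K = A × B` of two
commutative, mutually commuting subgroups is commutative (`K = A ⊔ B ≤ Z_G(A ∪ B) = Z_G(K)`).
[cite: MochizukiAbsTopII2013, Prop 1.3 (ii) proof p.13] -/
theorem AbsTopII.IsInternalProduct.comm_of_comm {A B K : Subgroup G}
    (h : AbsTopII.IsInternalProduct A B K)
    (hA : ∀ a ∈ A, ∀ a' ∈ A, a * a' = a' * a) (hB : ∀ b ∈ B, ∀ b' ∈ B, b * b' = b' * b) :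
    ∀ x ∈ K, ∀ y ∈ K, x * y = y * x := by
  have hle : K ≤ Subgroup.centralizer (K : Set G) := by
    rw [← h.sup_eq, Subgroup.sup_eq_closure, Subgroup.centralizer_closure, Subgroup.closure_le]
    intro x hx
    rw [SetLike.mem_coe, Subgroup.mem_centralizer_iff]
    rintro z (hz | hz)
    · rcases hx with hx | hx
      · exact hA z hz x hx
      · exact h.commute z hz x hx
    · rcases hx with hx | hx
      · exact (h.commute x hx z hz).symm
      · exact hB z hz x hx
  intro x hx y hy
  exact (Subgroup.mem_centralizer_iff.mp (hle hx) y hy).symm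

/-- "`≅ Ẑ^Σ`" ⇒ abelian, for a subgroup: a subgroup of a Hausdorff topological group with a dense
cyclic subgroup is commutative (tree `mul_comm_of_dense_zpowers`).
[cite: MochizukiAbsTopII2013, Prop 1.3 (i) p.11] -/
theorem AbsTopII.IsFreeProSigmaCyclic.subgroup_comm [TopologicalSpace G] [IsTopologicalGroup G]
    [T2Space G] {S : Set ℕ} {A : Subgroup G} (h : AbsTopII.IsFreeProSigmaCyclic S ↥A) :
    ∀ a ∈ A, ∀ a' ∈ A, a * a' = a' * a := by
  intro a ha a' ha'
  obtain ⟨g, hg⟩ := h.exists_dense_zpowers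
  exact congrArg Subtype.val (mul_comm_of_dense_zpowers hg ⟨a, ha⟩ ⟨a', ha'⟩)

end GroupTheory

/-! ## The identification `Im(Π^Σ_ν) = I_e` at the DPSC data -/

namespace DPSCData

variable (X : DPSCData.{u})

/-- **p. 13: "`I_e ∩ Π_𝔾 = Π_e` [cf. [Mzk13], Proposition 1.2, (ii)]"** for the typed
`I_e := Z_{Π_I}(Π_e)` of a node `e`: PROVED from the commensurable terminality of `Π_e` in `Π_𝔾`
(`Z_{Π_I}(Π_e) ∩ Π_𝔾 ⊆ N_{Π_H}(Π_e) ∩ Π_𝔾 = Π_e`) and "`Π_e` abelian" (`Π_e ⊆ Z(Π_e)`).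
[cite: MochizukiAbsTopII2013, Prop 1.3 (ii) proof p.13] -/
theorem IvNode_inf_PiG_eq (e : X.Node)
    (hCT : IsCommensurablyTerminal ((X.nodeSub e).subgroupOf X.PiG))
    (hcomm : ∀ a ∈ X.nodeSub e, ∀ b ∈ X.nodeSub e, a * b = b * a) :
    X.IvNode e ⊓ X.PiG = X.nodeSub e := by
  have hCT' : Subgroup.Commensurable.commensurator (X.nodeSub e) ⊓ X.PiG ≤ X.nodeSub e :=
    (isCommensurablyTerminal_subgroupOf_iff (X.nodeSub_le e)).mp hCT
  have hDN : Subgroup.normalizer (X.nodeSub e : Set X.PiH) ⊓ X.PiG = X.nodeSub e :=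
    normalizer_inf_eq_of_ctIn (X.nodeSub_le e) hCT'
  apply le_antisymm
  · -- `Z_{Π_I}(Π_e) ∩ Π_𝔾 ⊆ N(Π_e) ∩ Π_𝔾 = Π_e`
    calc X.IvNode e ⊓ X.PiG
        ≤ Subgroup.normalizer (X.nodeSub e : Set X.PiH) ⊓ X.PiG :=
          inf_le_inf_right _ (le_trans inf_le_left (Subgroup.centralizer_le_normalizer _))
      _ = X.nodeSub e := hDN
  · -- `Π_e ⊆ Z_{Π_I}(Π_e)` as `Π_e` is abelian, `Π_e ⊆ Π_𝔾 ⊆ Π_I`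
    refine le_inf (le_inf (fun a ha => ?_) (le_trans (X.nodeSub_le e) X.PiG_le_PiI)) (X.nodeSub_le e)
    rw [Subgroup.mem_centralizer_iff]
    intro b hb
    exact hcomm b hb a ha

/-- **p. 13, THE IDENTIFICATION "`Im(Π^Σ_ν) = I_e`"**: "we obtain an injection `Π^Σ_ν ↪ Π_I` whose
image [`J`] contains `Π_e` and surjects onto `I`. Since `Π^Σ_ν` is abelian, it follows that the image
… is contained in `I_e`; since `I_e ∩ Π_𝔾 = Π_e` …, we thus conclude that `Im(Π^Σ_ν) = I_e`" — for
ANY commutative subgroup `J` with `Π_e ≤ J` and `J · Π_𝔾 = Π_I`: `J ⊆ Z_{Π_I}(Π_e) = I_e`, and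
`I_e ⊆ J · Π_𝔾` with `I_e ∩ Π_𝔾 = Π_e ⊆ J` gives `I_e ⊆ J`.
[cite: MochizukiAbsTopII2013, Prop 1.3 (ii) proof p.13] -/
theorem IvNode_eq_of_image (e : X.Node)
    (hCT : IsCommensurablyTerminal ((X.nodeSub e).subgroupOf X.PiG))
    {J : Subgroup X.PiH} (hPe : X.nodeSub e ≤ J) (hsurj : J ⊔ X.PiG = X.PiI)
    (hJ : ∀ a ∈ J, ∀ b ∈ J, a * b = b * a) : X.IvNode e = J := by
  haveI : X.PiG.Normal := X.normal_PiG
  have hcomm : ∀ a ∈ X.nodeSub e, ∀ b ∈ X.nodeSub e, a * b = b * a :=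
    fun a ha b hb => hJ a (hPe ha) b (hPe hb)
  -- "Since `Π^Σ_ν` is abelian, the image is contained in `I_e`"
  have hJI : J ≤ X.IvNode e := by
    refine le_inf (fun a ha => ?_) (le_trans le_sup_left (le_of_eq hsurj))
    rw [Subgroup.mem_centralizer_iff]
    intro b hb
    exact hJ b (hPe hb) a ha
  -- "since `I_e ∩ Π_𝔾 = Π_e`, we thus conclude that `Im(Π^Σ_ν) = I_e`"
  have h := inf_eq_sup_of_sup_eq hsurj hJI (X.IvNode_inf_PiG_eq e hCT hcomm) X.PiG_le_PiI
  have hIle : X.IvNode e ≤ X.PiI := inf_le_right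
  rw [inf_eq_left.mpr hIle, sup_eq_left.mpr hPe] at h
  exact h

/-- **p. 13: the "natural exact sequence `1 → Π_e → I_e → I → 1`"** of a node — `Π_e ≤ I_e`,
`I_e ∩ Π_𝔾 = Π_e`, `I_e · Π_𝔾 = Π_I` — PROVED from [CombGC] Prop 1.2 (ii) for `Π_e` and the image
`J` of `Π^Σ_ν` (commutative, `Π_e ≤ J`, `J · Π_𝔾 = Π_I`).
[cite: MochizukiAbsTopII2013, Prop 1.3 (ii) p.11] -/
theorem IvNode_exact_of_image (e : X.Node)
    (hCT : IsCommensurablyTerminal ((X.nodeSub e).subgroupOf X.PiG))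
    {J : Subgroup X.PiH} (hPe : X.nodeSub e ≤ J) (hsurj : J ⊔ X.PiG = X.PiI)
    (hJ : ∀ a ∈ J, ∀ b ∈ J, a * b = b * a) :
    X.nodeSub e ≤ X.IvNode e ∧ X.IvNode e ⊓ X.PiG = X.nodeSub e ∧ X.IvNode e ⊔ X.PiG = X.PiI := by
  have hE := X.IvNode_eq_of_image e hCT hPe hsurj hJ
  refine ⟨hE ▸ hPe, X.IvNode_inf_PiG_eq e hCT fun a ha b hb => hJ a (hPe ha) b (hPe hb), ?_⟩
  rw [hE, hsurj]

end DPSCData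

/-! ## Assembly: Prop 1.3 (ii) as typed -/

namespace AbsTopII.DPSCIndexData

variable (X : DPSCIndexData.{u})

/-- **[AbsTopII] Prop 1.3 (ii) as typed** (`DPSCIndexData.Prop_1_3_ii`, F-0298) from its printed
inputs: [CombGC] Prop 1.2 (ii) for the nodal subgroups (`hCTn`), and, for each node `e`, the printed
computation of the image `J = Im(Π^Σ_ν ↪ Π_I)` (pp. 12–13), stated for an ABSTRACT subgroup `J`:
it contains `Π_e`, surjects onto `I` (`J · Π_𝔾 = Π_I`), is "`≅ Ẑ^Σ × Ẑ^Σ`" (an internal product of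
two closed free pro-`Σ`-cyclic subgroups), and "[for appropriate choices of conjugates] the natural
morphism `I_v × I_{v'} → J` is an open injective homomorphism, with image of index equal to `i^Σ_e`".
PROVED: `J` is abelian, hence `J = I_e := Z_{Π_I}(Π_e)` ("we thus conclude that `Im(Π^Σ_ν) = I_e`"),
and every clause of the typed (ii) follows. [cite: MochizukiAbsTopII2013, Prop 1.3 (ii) p.11] -/
theorem prop_1_3_ii_of_inputs
    (hCTn : ∀ e : X.Node, IsCommensurablyTerminal ((X.nodeSub e).subgroupOf X.PiG))
    (hν : ∀ e : X.Node, ∃ J : Subgroup X.PiH, X.nodeSub e ≤ J ∧ J ⊔ X.PiG = X.PiI ∧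
      (∃ A B : Subgroup X.PiH, IsClosed (A : Set X.PiH) ∧ IsClosed (B : Set X.PiH) ∧
        IsFreeProSigmaCyclic X.Sigma A ∧ IsFreeProSigmaCyclic X.Sigma B ∧
        IsInternalProduct A B J) ∧
      ∀ v v' : X.Vert, X.nodeAbuts e v → X.nodeAbuts e v' →
        ∃ g g' : X.PiH, ∃ K : Subgroup X.PiH,
          IsInternalProduct (MulAut.conj g • X.Iv v) (MulAut.conj g' • X.Iv v') K ∧
          K ≤ J ∧ IsOpen ((K.subgroupOf J : Subgroup ↥J) : Set ↥J) ∧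
          K.relIndex J = X.sigmaIndex e) :
    Literature.AnabelianGeometry.AbsoluteAnabelian.AbsTopII.DPSCIndexData.Prop_1_3_ii X := by
  intro e
  obtain ⟨J, hPe, hsurj, ⟨A, B, hAc, hBc, hA, hB, hprod⟩, hvv⟩ := hν e
  -- "Since `Π^Σ_ν` is abelian": from `J ≅ Ẑ^Σ × Ẑ^Σ`
  have hJ : ∀ a ∈ J, ∀ b ∈ J, a * b = b * a :=
    hprod.comm_of_comm hA.subgroup_comm hB.subgroup_comm
  -- "we thus conclude that `Im(Π^Σ_ν) = I_e`"
  have hE : X.IvNode e = J := X.toDPSCData.IvNode_eq_of_image e (hCTn e) hPe hsurj hJ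
  have hexact := X.toDPSCData.IvNode_exact_of_image e (hCTn e) hPe hsurj hJ
  subst hE
  exact ⟨hexact, ⟨A, B, hAc, hBc, hA, hB, hprod⟩, hvv⟩

end AbsTopII.DPSCIndexData

end Literature.AnabelianGeometry.AbsoluteAnabelian
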